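import Summits.AnomalousDissipation.AnomalousDissipation.Theorems.SolenoidalFractalHomogenisationLagrangianStepBandKillDuality
import Literature.Analysis.FluidPDE.PassiveVectorTensorPropagatorBandKill
import Literature.Analysis.FunctionSpaces.TorusHeatSmoothing
import HarnessLib

/-!
# W3-E (ii) `stub_effectiveFrameEnergyL_bandKill`: the two CORES of the assembly — band kill from the dissipation floor
# (short-separation regime) and from the ladder bounds (long-separation regime) (helper for K1L_D `stmt-AnomalousDissipation-27980`)

Summits-side helper file (everything proved; no definitions, no named facts).  Pure Hilbert-space bookkeeping on `V2 = L²(𝕋³; ℝ³)` for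
a bounded operator `T` and its adjoint, in the currency of the registered stub (rates `r_k = κ ‖k‖²`, exponent `ϱ = κ L'²`, `2L' ≤ L`,
leak `ℓ`):
* §1 `norm_sq_apply_le_of_floor`: the dissipation floor `‖T y‖² ≤ ‖y‖² − ½ Σ' min(1, r_k)|ŷ_k|²` gives, for `y` with no modes in the
  ball `|k| ≤ L`, `‖T y‖² ≤ (1 − ½ min(1, 4ϱ)) ‖y‖²`; hence (`norm_apply_le_of_floor`) `‖T y‖ ≤ (e^{−ϱ/2} + ℓ) ‖y‖` as soon as `ℓ ≥ 3/4`
  — clause (ii-in) in the SHORT-SEPARATION regime (`e^{−(L−L')/(C₂N_m)}` close to `1`), from clause (i) alone;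
* §2 `norm_sub_cutLp_apply_le_of_floor_of_capture`: clause (ii-out) in the same regime from the floor for `T†` and a LOW-MODE CAPTURE
  bound `‖cutLp L' (T† z)‖ ≤ ε ‖z‖` (`z` off the ball `L`), whenever `ℓ ≥ 3/4 + ε` (the duality step of `…BandKillDuality`);
* §3 `bandKill_of_ladder`: both clauses in the LONG-SEPARATION regime from the ladder bounds for `T` and `T†`
  (`‖cutLp L' (T† z)‖ ≤ ε‖z‖`, `‖T† z‖, ‖T z‖ ≤ (e^{−ϱ/2} + ε)‖z‖` for `z` off the ball `L`) whenever `2ε ≤ ℓ`.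
Infrastructure for route-1's rung leaf F-D1.A0 (a frontier FORMAL rung); NOT a proof of anomalous dissipation.
-/

set_option linter.dupNamespace false

namespace Summit.AnomalousDissipation.AnomalousDissipation.Theorems.SolenoidalFractalHomogenisation.LagrangianStep

open Literature.Analysis Literature.Analysis.FluidPDE Literature.Analysis.FunctionSpaces
open MeasureTheory Set Filter
open scoped ENNReal NNReal InnerProductSpace

noncomputable section

namespace OneLevelSplit

/-! ## §1 From the dissipation floor -/

/-- `‖y − cutLp N y‖ ≤ ‖y‖` (Pythagoras). -/
theorem norm_sub_cutLp_le (N : ℕ) (y : V2) : ‖y - cutLp N y‖ ≤ ‖y‖ := by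
  have h := norm_sub_cutLp_sq N y
  have h1 : ‖y - cutLp N y‖ ^ 2 ≤ ‖y‖ ^ 2 := by rw [h]; nlinarith [sq_nonneg ‖cutLp N y‖]
  exact (pow_le_pow_iff_left₀ (norm_nonneg _) (norm_nonneg _) two_ne_zero).1 h1

/-- Off the ball `|k| ≤ L` with `2L' ≤ L`, the rates `κ‖k‖²` are at least `4 κ L'²`. -/
theorem four_mul_le_rate_of_not_mem_freqBall {κ : ℝ} (hκ : 0 ≤ κ) {L L' : ℕ} (hL : 2 * L' ≤ L) {k : Fin 3 → ℤ}
    (hk : k ∉ Torus.freqBall L) : 4 * (κ * (L' : ℝ) ^ 2) ≤ κ * ‖Torus.latticeVec k‖ ^ 2 := by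
  rw [Torus.mem_freqBall, not_le] at hk
  rw [Torus.norm_latticeVec_sq]
  have hL' : (2 * L' : ℝ) ≤ L := by exact_mod_cast hL
  have hL0 : (0 : ℝ) ≤ (L' : ℝ) := Nat.cast_nonneg L'
  have h4 : 4 * (L' : ℝ) ^ 2 ≤ (L : ℝ) ^ 2 := by nlinarith
  nlinarith

/-- **The floor off the ball**: if `‖T y‖² ≤ ‖y‖² − ½ Σ' min(1, κ‖k‖²)|ŷ_k|²` for all `y`, then for `y` with no Fourier modes in the ball
`|k| ≤ L` (`2L' ≤ L`), `‖T y‖² ≤ (1 − ½ min(1, 4κL'²)) ‖y‖²`. -/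
theorem norm_sq_apply_le_of_floor (T : V2 →L[ℝ] V2) {κ : ℝ} (hκ : 0 ≤ κ)
    (hfloor : ∀ y : V2, ‖T y‖ ^ 2 ≤ ‖y‖ ^ 2 - 1 / 2 * ∑' k : Fin 3 → ℤ,
      min 1 (κ * ‖Torus.latticeVec k‖ ^ 2) * ‖UnitAddTorus.mFourierCoeff (EuclideanSpace.complexify ∘ (y : VF)) k‖ ^ 2)
    {L L' : ℕ} (hL : 2 * L' ≤ L) (y : V2)
    (hy : ∀ k ∈ Torus.freqBall L, UnitAddTorus.mFourierCoeff (EuclideanSpace.complexify ∘ (y : VF)) k = 0) :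
    ‖T y‖ ^ 2 ≤ (1 - 1 / 2 * min 1 (4 * (κ * (L' : ℝ) ^ 2))) * ‖y‖ ^ 2 := by
  classical
  set c : (Fin 3 → ℤ) → ℝ := fun k => ‖UnitAddTorus.mFourierCoeff (EuclideanSpace.complexify ∘ (y : VF)) k‖ ^ 2 with hc
  have hpar : HasSum c (‖y‖ ^ 2) := by
    rw [Torus.norm_sq_eq_integral_norm_sq]
    exact Torus.hasSum_sq_norm_mFourierCoeff_complexify (Lp.memLp y)
  have hc0 : ∀ k, 0 ≤ c k := fun k => sq_nonneg _
  set m0 : ℝ := min 1 (4 * (κ * (L' : ℝ) ^ 2)) with hm0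
  have hm00 : 0 ≤ m0 := le_min zero_le_one (by positivity)
  -- `m0 · c k ≤ min(1, r k) · c k` for every `k` (both sides vanish on the ball)
  have hpt : ∀ k, m0 * c k ≤ min 1 (κ * ‖Torus.latticeVec k‖ ^ 2) * c k := by
    intro k
    by_cases hk : k ∈ Torus.freqBall L
    · have : c k = 0 := by rw [hc]; simp only; rw [hy k hk, norm_zero]; ring
      rw [this, mul_zero, mul_zero]
    · exact mul_le_mul_of_nonneg_right (min_le_min le_rfl (four_mul_le_rate_of_not_mem_freqBall hκ hL hk)) (hc0 k)
  have hs1 : Summable fun k => min 1 (κ * ‖Torus.latticeVec k‖ ^ 2) * c k :=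
    Summable.of_nonneg_of_le (fun k => mul_nonneg (le_min zero_le_one (by positivity)) (hc0 k))
      (fun k => mul_le_of_le_one_left (hc0 k) (min_le_left _ _)) hpar.summable
  have hle : m0 * ‖y‖ ^ 2 ≤ ∑' k, min 1 (κ * ‖Torus.latticeVec k‖ ^ 2) * c k := by
    rw [← hpar.tsum_eq, ← tsum_mul_left]
    exact (hpar.summable.mul_left m0).tsum_le_tsum hpt hs1
  have h := hfloor y
  nlinarith

/-- `1 − 2ϱ ≤ e^{−ϱ}` and `½ ≤ (3/4)²`: the floor factor is dominated by `(e^{−ϱ/2} + ℓ)²` once `ℓ ≥ 3/4`. -/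
theorem floor_factor_le_sq {ϱ ℓ : ℝ} (hϱ : 0 ≤ ϱ) (hℓ : 3 / 4 ≤ ℓ) :
    1 - 1 / 2 * min 1 (4 * ϱ) ≤ (Real.exp (-(ϱ / 2)) + ℓ) ^ 2 := by
  have he : 0 < Real.exp (-(ϱ / 2)) := Real.exp_pos _
  rcases le_or_gt 1 (4 * ϱ) with h4 | h4
  · rw [min_eq_left h4]
    nlinarith
  · rw [min_eq_right h4.le]
    -- `1 − 2ϱ ≤ e^{−ϱ} = (e^{−ϱ/2})² ≤ (e^{−ϱ/2} + ℓ)²`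
    have h1 : 1 - 2 * ϱ ≤ Real.exp (-(ϱ / 2)) ^ 2 := by
      rw [← Real.exp_nat_mul]
      have := Real.add_one_le_exp (-(ϱ))
      have e : (2 : ℕ) * (-(ϱ / 2)) = -ϱ := by push_cast; ring
      rw [e]; nlinarith
    nlinarith

/-- **Clause (ii-in) from the floor** (short-separation regime): if `ℓ ≥ 3/4` then `‖T y‖ ≤ (e^{−κL'²/2} + ℓ) ‖y‖` for every `y` with
`cutLp L y = 0`. -/
theorem norm_apply_le_of_floor (T : V2 →L[ℝ] V2) {κ : ℝ} (hκ : 0 ≤ κ)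
    (hfloor : ∀ y : V2, ‖T y‖ ^ 2 ≤ ‖y‖ ^ 2 - 1 / 2 * ∑' k : Fin 3 → ℤ,
      min 1 (κ * ‖Torus.latticeVec k‖ ^ 2) * ‖UnitAddTorus.mFourierCoeff (EuclideanSpace.complexify ∘ (y : VF)) k‖ ^ 2)
    {L L' : ℕ} (hL : 2 * L' ≤ L) {ℓ : ℝ} (hℓ : 3 / 4 ≤ ℓ) (y : V2)
    (hy : ∀ k ∈ Torus.freqBall L, UnitAddTorus.mFourierCoeff (EuclideanSpace.complexify ∘ (y : VF)) k = 0) :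
    ‖T y‖ ≤ (Real.exp (-(κ * (L' : ℝ) ^ 2 / 2)) + ℓ) * ‖y‖ := by
  have h1 := norm_sq_apply_le_of_floor T hκ hfloor hL y hy
  have h2 := floor_factor_le_sq (ϱ := κ * (L' : ℝ) ^ 2) (by positivity) hℓ
  have h0 : 0 ≤ Real.exp (-(κ * (L' : ℝ) ^ 2 / 2)) + ℓ := by positivity
  have h3 : ‖T y‖ ^ 2 ≤ ((Real.exp (-(κ * (L' : ℝ) ^ 2 / 2)) + ℓ) * ‖y‖) ^ 2 := by
    rw [mul_pow]
    exact h1.trans (mul_le_mul_of_nonneg_right h2 (sq_nonneg _))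
  exact (pow_le_pow_iff_left₀ (norm_nonneg _) (by positivity) two_ne_zero).1 h3

/-! ## §2 Clause (ii-out) from the floor and a low-mode capture bound -/

/-- **Clause (ii-out), short-separation regime**: the floor for `T†`, a capture bound `‖cutLp L' (T† z)‖ ≤ ε‖z‖` for `z` off the ball `L`,
and `ℓ ≥ 3/4 + ε` give `‖T y − cutLp L (T y)‖ ≤ e^{−κL'²/2} ‖y − cutLp L' y‖ + ℓ ‖y‖` for every `y`. -/
theorem norm_sub_cutLp_apply_le_of_floor_of_capture (T : V2 →L[ℝ] V2) {κ : ℝ} (hκ : 0 ≤ κ)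
    (hfloor : ∀ y : V2, ‖ContinuousLinearMap.adjoint T y‖ ^ 2 ≤ ‖y‖ ^ 2 - 1 / 2 * ∑' k : Fin 3 → ℤ,
      min 1 (κ * ‖Torus.latticeVec k‖ ^ 2) * ‖UnitAddTorus.mFourierCoeff (EuclideanSpace.complexify ∘ (y : VF)) k‖ ^ 2)
    {L L' : ℕ} (hL : 2 * L' ≤ L) {ε ℓ : ℝ} (hε : 0 ≤ ε) (hℓ : 3 / 4 + ε ≤ ℓ)
    (hcap : ∀ z : V2, (∀ k ∈ Torus.freqBall L, UnitAddTorus.mFourierCoeff (EuclideanSpace.complexify ∘ (z : VF)) k = 0) →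
      ‖cutLp L' (ContinuousLinearMap.adjoint T z)‖ ≤ ε * ‖z‖)
    (y : V2) :
    ‖T y - cutLp L (T y)‖ ≤ Real.exp (-(κ * (L' : ℝ) ^ 2 / 2)) * ‖y - cutLp L' y‖ + ℓ * ‖y‖ := by
  set α : ℝ := Real.sqrt (1 - 1 / 2 * min 1 (4 * (κ * (L' : ℝ) ^ 2))) with hα
  have hfac0 : 0 ≤ 1 - 1 / 2 * min 1 (4 * (κ * (L' : ℝ) ^ 2)) := by
    have := min_le_left (1 : ℝ) (4 * (κ * (L' : ℝ) ^ 2)); linarith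
  have hα0 : 0 ≤ α := Real.sqrt_nonneg _
  have h1 : ∀ z : V2, (∀ k ∈ Torus.freqBall L, UnitAddTorus.mFourierCoeff (EuclideanSpace.complexify ∘ (z : VF)) k = 0) →
      ‖ContinuousLinearMap.adjoint T z‖ ≤ α * ‖z‖ := by
    intro z hz
    have h := norm_sq_apply_le_of_floor (ContinuousLinearMap.adjoint T) hκ hfloor hL z hz
    have h' : ‖ContinuousLinearMap.adjoint T z‖ ^ 2 ≤ (α * ‖z‖) ^ 2 := by
      rw [mul_pow, hα, Real.sq_sqrt hfac0]; exact h
    exact (pow_le_pow_iff_left₀ (norm_nonneg _) (by positivity) two_ne_zero).1 h'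
  have hmain := norm_sub_cutLp_apply_le_of_adjoint_bounds T hα0 hε h1 hcap y
  -- `α ≤ e^{−ϱ/2}` if `4ϱ < 1`, else `α ≤ 3/4`; in both cases the claim follows
  have hy2 : ‖y - cutLp L' y‖ ≤ ‖y‖ := norm_sub_cutLp_le L' y
  have he0 : 0 ≤ Real.exp (-(κ * (L' : ℝ) ^ 2 / 2)) := Real.exp_nonneg _
  rcases le_or_gt 1 (4 * (κ * (L' : ℝ) ^ 2)) with h4 | h4
  · have hα34 : α ≤ 3 / 4 := by
      rw [hα, min_eq_left h4]
      rw [show (1 : ℝ) - 1 / 2 * 1 = (Real.sqrt 2 / 2) ^ 2 by rw [div_pow, Real.sq_sqrt (by norm_num)]; norm_num,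
        Real.sqrt_sq (by positivity)]
      nlinarith [Real.sq_sqrt (show (0:ℝ) ≤ 2 by norm_num), Real.sqrt_nonneg 2]
    calc ‖T y - cutLp L (T y)‖ ≤ α * ‖y - cutLp L' y‖ + ε * ‖y‖ := hmain
      _ ≤ 3 / 4 * ‖y‖ + ε * ‖y‖ := by nlinarith [norm_nonneg (y - cutLp L' y), norm_nonneg y]
      _ ≤ Real.exp (-(κ * (L' : ℝ) ^ 2 / 2)) * ‖y - cutLp L' y‖ + ℓ * ‖y‖ := by
          nlinarith [norm_nonneg (y - cutLp L' y), norm_nonneg y]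
  · have hαe : α ≤ Real.exp (-(κ * (L' : ℝ) ^ 2 / 2)) := by
      rw [hα, min_eq_right h4.le]
      refine (Real.sqrt_le_sqrt ?_).trans (le_of_eq (Real.sqrt_sq he0))
      rw [← Real.exp_nat_mul]
      have := Real.add_one_le_exp (-(κ * (L' : ℝ) ^ 2))
      have hϱ0 : 0 ≤ κ * (L' : ℝ) ^ 2 := by positivity
      have e : (2 : ℕ) * (-(κ * (L' : ℝ) ^ 2 / 2)) = -(κ * (L' : ℝ) ^ 2) := by push_cast; ring
      rw [e]; nlinarith
    calc ‖T y - cutLp L (T y)‖ ≤ α * ‖y - cutLp L' y‖ + ε * ‖y‖ := hmain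
      _ ≤ Real.exp (-(κ * (L' : ℝ) ^ 2 / 2)) * ‖y - cutLp L' y‖ + ℓ * ‖y‖ := by
          nlinarith [norm_nonneg (y - cutLp L' y), norm_nonneg y]

/-! ## §3 Both clauses from the ladder bounds -/

/-- **Band kill from the ladder bounds** (long-separation regime): if for every `z` with no modes in the ball `|k| ≤ L`,
`‖T z‖ ≤ (e^{−ϱ/2} + ε)‖z‖`, `‖T† z‖ ≤ (e^{−ϱ/2} + ε)‖z‖` and `‖cutLp L' (T† z)‖ ≤ ε‖z‖`, and `2ε ≤ ℓ`, then (ii-out) and (ii-in) hold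
for `T` with leak `ℓ`. -/
theorem bandKill_of_ladder (T : V2 →L[ℝ] V2) {L L' : ℕ} {ϱ ε ℓ : ℝ} (hε : 0 ≤ ε) (hℓ : 2 * ε ≤ ℓ)
    (hT : ∀ z : V2, (∀ k ∈ Torus.freqBall L, UnitAddTorus.mFourierCoeff (EuclideanSpace.complexify ∘ (z : VF)) k = 0) →
      ‖T z‖ ≤ (Real.exp (-(ϱ / 2)) + ε) * ‖z‖)
    (hTa : ∀ z : V2, (∀ k ∈ Torus.freqBall L, UnitAddTorus.mFourierCoeff (EuclideanSpace.complexify ∘ (z : VF)) k = 0) →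
      ‖ContinuousLinearMap.adjoint T z‖ ≤ (Real.exp (-(ϱ / 2)) + ε) * ‖z‖)
    (hcap : ∀ z : V2, (∀ k ∈ Torus.freqBall L, UnitAddTorus.mFourierCoeff (EuclideanSpace.complexify ∘ (z : VF)) k = 0) →
      ‖cutLp L' (ContinuousLinearMap.adjoint T z)‖ ≤ ε * ‖z‖) :
    (∀ y : V2, ‖T y - cutLp L (T y)‖ ≤ Real.exp (-(ϱ / 2)) * ‖y - cutLp L' y‖ + ℓ * ‖y‖) ∧
      (∀ y : V2, cutLp L y = 0 → ‖T y‖ ≤ (Real.exp (-(ϱ / 2)) + ℓ) * ‖y‖) := by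
  have he0 : 0 ≤ Real.exp (-(ϱ / 2)) := Real.exp_nonneg _
  refine ⟨fun y => ?_, fun y hy => ?_⟩
  · have h := norm_sub_cutLp_apply_le_of_adjoint_bounds T (by positivity) hε hTa hcap y
    have hy2 : ‖y - cutLp L' y‖ ≤ ‖y‖ := norm_sub_cutLp_le L' y
    calc ‖T y - cutLp L (T y)‖ ≤ (Real.exp (-(ϱ / 2)) + ε) * ‖y - cutLp L' y‖ + ε * ‖y‖ := h
      _ = Real.exp (-(ϱ / 2)) * ‖y - cutLp L' y‖ + (ε * ‖y - cutLp L' y‖ + ε * ‖y‖) := by ring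
      _ ≤ Real.exp (-(ϱ / 2)) * ‖y - cutLp L' y‖ + ℓ * ‖y‖ := by nlinarith [norm_nonneg y, norm_nonneg (y - cutLp L' y)]
  · have h := norm_apply_le_of_cutLp_eq_zero T hT y hy
    calc ‖T y‖ ≤ (Real.exp (-(ϱ / 2)) + ε) * ‖y‖ := h
      _ ≤ (Real.exp (-(ϱ / 2)) + ℓ) * ‖y‖ := by nlinarith [norm_nonneg y]

end OneLevelSplit

end

end Summit.AnomalousDissipation.AnomalousDissipation.Theorems.SolenoidalFractalHomogenisation.LagrangianStep
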